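import Literature.Probability.RandomPlanarGeometry.SAWWeightedAutomata
import HarnessLib

/-!
# State-dependent letter weights for pruning automata (pattern-tilted Collatz–Wielandt bound)

Topic `Literature/Probability/RandomPlanarGeometry` (continues `SAWWeightedAutomata.lean`). In
`SAWWeightedAutomata.lean` each letter `d` carries a weight `W d`; here the weight of the letter may
depend on the STATE of the automaton that reads it, `W a d ∈ ℕ` — the device needed to tilt the
self-avoiding count by a LOCAL PATTERN (a turn, a tight U-turn, …), which is read off the last
remembered letters of the state together with the new letter. The weight of a word is the product
of the weights met along its run (`wprodS`; `0` if the run dies). If `R ∋ []` is closed under the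
transitions and `v ≥ 1` on `R` satisfies `D · Σ_d W(a,d) · v(step a d) ≤ N · v(a)` on `R`
(`CertificateS`), then the total weight of the surviving words of length `n` is at most
`(N/D)ⁿ · v([])` (`sum_liveWords_wprodS_mul_pow_le`), exactly as in the letter-weighted case
(Pönitz–Tittmann 2000, §3, with the exponential-tilting device of large-deviation theory).

## Contents (namespace `Literature.Probability.RandomPlanarGeometry.SAW.WordAutomaton`)

* `trackS`, `runS`, `runS_fst` (the tracked state is the run), `wprodS` and its `append` rules;
* `CertificateS step R v W N D`; `weightSumS`;
* `mul_weightSumS_succ_le` (`D Φₙ₊₁ ≤ N Φₙ`), `pow_mul_weightSumS_le` (`Dⁿ Φₙ ≤ Nⁿ v([])`),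
  **`sum_liveWords_wprodS_mul_pow_le`**: `(Σ_{w live, |w|=n} wprodS w) · Dⁿ ≤ Nⁿ · v([])`,
  **`sum_sawWords_wprodS_mul_pow_le`**: the same over the self-avoiding words when they all survive.

## References

* A. Pönitz, P. Tittmann, *Improved upper bounds for self-avoiding walks in ℤᵈ*, Electron. J.
  Combin. 7 (2000) R21, §3 [PonitzTittmann2000].
* N. Madras, G. Slade, *The Self-Avoiding Walk* (1993), §1.2 (submultiplicativity) [MadrasSlade1993].
-/

open Finset
open scoped BigOperators

namespace Literature.Probability.RandomPlanarGeometry.SAW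

namespace WordAutomaton

variable (step : List Step → Step → Option (List Step))

/-! ### The weight of a word read along its run -/

/-- One step of the weight tracker: from (state, accumulated weight) read the letter `d`; a dead
run stays dead with weight `0`. [cite: PonitzTittmann2000, §3] -/
def trackS (W : List Step → Step → ℕ) (o : Option (List Step) × ℕ) (d : Step) :
    Option (List Step) × ℕ :=
  match o.1 with
  | none => (none, 0)
  | some a => (step a d, o.2 * W a d)

/-- The tracked run: final state and accumulated weight. [cite: PonitzTittmann2000, §3] -/
def runS (W : List Step → Step → ℕ) (w : List Step) : Option (List Step) × ℕ :=
  w.foldl (trackS step W) (some [], 1)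

/-- The tracked run of the empty word. [cite: PonitzTittmann2000, §3] -/
@[simp] theorem runS_nil (W : List Step → Step → ℕ) : runS step W [] = (some [], 1) := rfl

/-- Reading one more letter. [cite: PonitzTittmann2000, §3] -/
theorem runS_append_singleton (W : List Step → Step → ℕ) (w : List Step) (d : Step) :
    runS step W (w ++ [d]) = trackS step W (runS step W w) d := by
  simp [runS, List.foldl_append]

/-- The tracked state is the run of the automaton. [cite: PonitzTittmann2000, §3] -/
theorem runS_fst (W : List Step → Step → ℕ) (w : List Step) : (runS step W w).1 = run step w := by
  induction w using List.reverseRecOn with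
  | nil => rfl
  | append_singleton w d ih =>
    rw [runS_append_singleton, run_append_singleton, ← ih]
    cases h : (runS step W w).1 with
    | none => simp [trackS, h]
    | some a => simp [trackS, h]

/-- **The state-dependent weight of a word**: the product of the weights `W(state, letter)` met
along its run (`0` if the run dies before the end). [cite: PonitzTittmann2000, §3] -/
def wprodS (W : List Step → Step → ℕ) (w : List Step) : ℕ := (runS step W w).2

/-- `wprodS` of the empty word. [cite: PonitzTittmann2000, §3] -/
@[simp] theorem wprodS_nil (W : List Step → Step → ℕ) : wprodS step W [] = 1 := rfl

variable {step}

/-- `wprodS` of a word with one more letter, the run being alive in state `a`. [cite: PonitzTittmann2000, §3] -/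
theorem wprodS_append_singleton_of_run {W : List Step → Step → ℕ} {w : List Step} {a : List Step}
    (h : run step w = some a) (d : Step) :
    wprodS step W (w ++ [d]) = wprodS step W w * W a d := by
  have h1 : (runS step W w).1 = some a := by rw [runS_fst]; exact h
  simp only [wprodS, runS_append_singleton, trackS, h1]

/-- `wprodS` of a word with one more letter, the run being dead. [cite: PonitzTittmann2000, §3] -/
theorem wprodS_append_singleton_of_run_none {W : List Step → Step → ℕ} {w : List Step}
    (h : run step w = none) (d : Step) : wprodS step W (w ++ [d]) = 0 := by
  have h1 : (runS step W w).1 = none := by rw [runS_fst]; exact h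
  simp only [wprodS, runS_append_singleton, trackS, h1]

/-! ### Certificates with state-dependent weights -/

/-- A **Collatz–Wielandt certificate with state-dependent letter weights** for the automaton
`step`, weights `W` and ratio `N/D`: a set of states `R ∋ []` closed under the transitions and a
weight `v ≥ 1` on `R` with `D · Σ_d W(a,d) · v(step a d) ≤ N · v a` for `a ∈ R`.
[cite: PonitzTittmann2000, §3] -/
structure CertificateS (step : List Step → Step → Option (List Step)) (R : Set (List Step)) (v : List Step → ℕ) (W : List Step → Step → ℕ)
    (N D : ℕ) : Prop where
  /-- the initial state is in `R` -/
  nil_mem : [] ∈ R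
  /-- `R` is closed under the transitions -/
  closed : ∀ a ∈ R, ∀ d b, step a d = some b → b ∈ R
  /-- the weight is positive on `R` -/
  one_le : ∀ a ∈ R, 1 ≤ v a
  /-- weighted sub-invariance of the weight -/
  subinv : ∀ a ∈ R, D * ∑ d : Step, W a d * ((step a d).map v).getD 0 ≤ N * v a

/-- The weighted total `Φₙ = Σ_{|w| = n} wprodS(w) · v(run w)` of the runs of length `n`.
[cite: PonitzTittmann2000, §3] -/
def weightSumS (step : List Step → Step → Option (List Step)) (v : List Step → ℕ)
    (W : List Step → Step → ℕ) (n : ℕ) : ℕ :=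
  ∑ w ∈ words n, wprodS step W w * phi v (run step w)

/-- `Φ₀ = v([])`. [cite: PonitzTittmann2000, §3] -/
theorem weightSumS_zero (v : List Step → ℕ) (W : List Step → Step → ℕ) :
    weightSumS step v W 0 = v [] := by
  simp [weightSumS, words]

/-- Surviving runs stay in the closed set `R`. [cite: PonitzTittmann2000, §3] -/
theorem CertificateS.run_mem {R : Set (List Step)} {v : List Step → ℕ} {W : List Step → Step → ℕ}
    {N D : ℕ} (hc : CertificateS step R v W N D) (w : List Step) {a : List Step}
    (h : run step w = some a) : a ∈ R := by
  induction w using List.reverseRecOn generalizing a with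
  | nil => simp only [run_nil, Option.some.injEq] at h; subst h; exact hc.nil_mem
  | append_singleton w d ih =>
    rw [run_append_singleton] at h
    cases hw : run step w with
    | none => simp [hw] at h
    | some a' => rw [hw, Option.bind_some] at h; exact hc.closed a' (ih hw) d a h

/-- **One step of the weighted count**: `D · Φₙ₊₁ ≤ N · Φₙ`. [cite: PonitzTittmann2000, §3] -/
theorem mul_weightSumS_succ_le {R : Set (List Step)} {v : List Step → ℕ} {W : List Step → Step → ℕ}
    {N D : ℕ} (hc : CertificateS step R v W N D) (n : ℕ) :
    D * weightSumS step v W (n + 1) ≤ N * weightSumS step v W n := by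
  rw [weightSumS, weightSumS, sum_words_succ, mul_sum, mul_sum]
  refine sum_le_sum fun w _ => ?_
  cases hw : run step w with
  | none => simp [run_append_singleton, hw, wprodS_append_singleton_of_run_none hw]
  | some a =>
    have ha : a ∈ R := hc.run_mem w hw
    simp only [run_append_singleton, hw, Option.bind_some, phi_eq_getD,
      wprodS_append_singleton_of_run hw]
    have := hc.subinv a ha
    calc D * ∑ d : Step, wprodS step W w * W a d * ((step a d).map v).getD 0
        = wprodS step W w * (D * ∑ d : Step, W a d * ((step a d).map v).getD 0) := by
          rw [mul_sum, mul_sum, mul_sum]; exact sum_congr rfl fun d _ => by ring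
      _ ≤ wprodS step W w * (N * v a) := Nat.mul_le_mul_left _ this
      _ = N * (wprodS step W w * v a) := by ring
      _ = N * (wprodS step W w * (Option.map v (some a)).getD 0) := by simp

/-- **`Dⁿ Φₙ ≤ Nⁿ v([])`**. [cite: PonitzTittmann2000, §3] -/
theorem pow_mul_weightSumS_le {R : Set (List Step)} {v : List Step → ℕ} {W : List Step → Step → ℕ}
    {N D : ℕ} (hc : CertificateS step R v W N D) (n : ℕ) :
    D ^ n * weightSumS step v W n ≤ N ^ n * v [] := by
  induction n with
  | zero => simp [weightSumS_zero]
  | succ n ih =>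
    calc D ^ (n + 1) * weightSumS step v W (n + 1)
        = D ^ n * (D * weightSumS step v W (n + 1)) := by ring
      _ ≤ D ^ n * (N * weightSumS step v W n) := Nat.mul_le_mul_left _ (mul_weightSumS_succ_le hc n)
      _ = N * (D ^ n * weightSumS step v W n) := by ring
      _ ≤ N * (N ^ n * v []) := Nat.mul_le_mul_left _ ih
      _ = N ^ (n + 1) * v [] := by ring

/-- The total weight of the surviving words is at most the weighted count. [cite: PonitzTittmann2000, §3] -/
theorem sum_liveWords_wprodS_le_weightSumS {R : Set (List Step)} {v : List Step → ℕ}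
    {W : List Step → Step → ℕ} {N D : ℕ} (hc : CertificateS step R v W N D) (n : ℕ) :
    ∑ w ∈ liveWords step n, wprodS step W w ≤ weightSumS step v W n := by
  rw [liveWords, sum_filter, weightSumS]
  refine sum_le_sum fun w _ => ?_
  split_ifs with h
  · cases hw : run step w with
    | none => exact absurd hw h
    | some a =>
      rw [phi_some]
      exact Nat.le_mul_of_pos_right _ (hc.one_le a (hc.run_mem w hw))
  · exact Nat.zero_le _

/-- **Pattern-tilted Collatz–Wielandt bound for the surviving words**:
`(Σ_{w live, |w| = n} wprodS(w)) · Dⁿ ≤ Nⁿ · v([])`. [cite: PonitzTittmann2000, §3] -/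
theorem sum_liveWords_wprodS_mul_pow_le {R : Set (List Step)} {v : List Step → ℕ}
    {W : List Step → Step → ℕ} {N D : ℕ} (hc : CertificateS step R v W N D) (n : ℕ) :
    (∑ w ∈ liveWords step n, wprodS step W w) * D ^ n ≤ N ^ n * v [] :=
  calc (∑ w ∈ liveWords step n, wprodS step W w) * D ^ n ≤ weightSumS step v W n * D ^ n :=
        Nat.mul_le_mul_right _ (sum_liveWords_wprodS_le_weightSumS hc n)
    _ = D ^ n * weightSumS step v W n := mul_comm _ _
    _ ≤ N ^ n * v [] := pow_mul_weightSumS_le hc n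

/-- If every self-avoiding word survives, the **pattern-tilted self-avoiding count** obeys
`(Σ_{w ∈ sawWords n} wprodS(w)) · Dⁿ ≤ Nⁿ · v([])`. [cite: PonitzTittmann2000, §3] -/
theorem sum_sawWords_wprodS_mul_pow_le {R : Set (List Step)} {v : List Step → ℕ}
    {W : List Step → Step → ℕ} {N D : ℕ} (hc : CertificateS step R v W N D)
    (hsaw : ∀ w, IsSAW w → run step w ≠ none) (n : ℕ) :
    (∑ w ∈ sawWords n, wprodS step W w) * D ^ n ≤ N ^ n * v [] := by
  refine le_trans (Nat.mul_le_mul_right _ ?_) (sum_liveWords_wprodS_mul_pow_le hc n)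
  refine sum_le_sum_of_subset_of_nonneg (fun w hw => ?_) fun _ _ _ => Nat.zero_le _
  rw [mem_sawWords] at hw
  exact (mem_liveWords step).2 ⟨hw.1, hsaw w hw.2⟩

end WordAutomaton

end Literature.Probability.RandomPlanarGeometry.SAW
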